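import Mathlib
import HarnessLib
import Summits.HubbardSuperconductivity.HubbardSuperconductivity.Theses.ChiralWindow

/-!
# Route `ChiralWindow`, support `CwChannelInfContinuous` (item `stmt-HubbardSuperconductivity-1744`):
Hilbert–Schmidt control of a quadratic form given by an iterated integral

A generic measure-theoretic helper for the `μ`-continuity of the channel bottom `channelInf`:
for `Ψ ∈ L²(λ)` and a kernel `M ∈ L²(λ ⊗ λ)`,

* `integral_mul_integral_mul_eq_integral_prod` — the iterated integral
  `∫ Ψ(x) (∫ M(x,y) Ψ(y) dy) dx` equals the product integral `∫ M (Ψ ⊗ Ψ) d(λ ⊗ λ)` (Fubini);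
* `abs_integral_mul_le_sqrt_mul_sqrt` — Cauchy–Schwarz for real `L²` functions;
* `abs_integral_mul_integral_mul_le` — **`|∫ Ψ (∫ M Ψ)| ≤ ‖Ψ‖₂² ‖M‖_{L²(λ⊗λ)}`**;
* `abs_iterated_sub_iterated_le` — **`|T(M₁, Ψ) - T(M₂, Ψ)| ≤ ‖Ψ‖₂² ‖M₁ - M₂‖_{L²(λ⊗λ)}`**, the form
  in which the change of the Kohn–Luttinger kernel with the chemical potential is fed into the
  variational problem.

No definitions. [folklore]
-/

noncomputable section

open MeasureTheory Real Set Filter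
open scoped ENNReal

-- the tree's namespace `Summit.<Summit>.<Problem>.Theorems` repeats the summit name by design (D-0017)
set_option linter.dupNamespace false

namespace Summit.HubbardSuperconductivity.HubbardSuperconductivity.Theorems

variable {α : Type*} [MeasurableSpace α]

/-! ### Cauchy–Schwarz in real `L²` -/

/-- `MemLp f 2` in the `ENNReal.ofReal 2` spelling used by Mathlib's Hölder inequality. [folklore] -/
theorem memLp_ofReal_two {μ : Measure α} {f : α → ℝ} (hf : MemLp f 2 μ) : MemLp f (ENNReal.ofReal 2) μ := by
  rwa [show ENNReal.ofReal 2 = 2 by norm_num]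

/-- **Cauchy–Schwarz**: `|∫ F G| ≤ √(∫ F²) √(∫ G²)` for real `L²` functions. [folklore] -/
theorem abs_integral_mul_le_sqrt_mul_sqrt {μ : Measure α} {F G : α → ℝ} (hF : MemLp F 2 μ) (hG : MemLp G 2 μ) :
    |∫ z, F z * G z ∂μ| ≤ Real.sqrt (∫ z, F z ^ 2 ∂μ) * Real.sqrt (∫ z, G z ^ 2 ∂μ) := by
  have h := integral_mul_norm_le_Lp_mul_Lq Real.HolderConjugate.two_two (memLp_ofReal_two hF)
    (memLp_ofReal_two hG)
  have hF2 : (∫ a, ‖F a‖ ^ (2 : ℝ) ∂μ) = ∫ a, F a ^ 2 ∂μ := by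
    refine integral_congr_ae (Eventually.of_forall fun a => ?_)
    simp only [Real.norm_eq_abs, Real.rpow_two, sq_abs]
  have hG2 : (∫ a, ‖G a‖ ^ (2 : ℝ) ∂μ) = ∫ a, G a ^ 2 ∂μ := by
    refine integral_congr_ae (Eventually.of_forall fun a => ?_)
    simp only [Real.norm_eq_abs, Real.rpow_two, sq_abs]
  rw [hF2, hG2, show (1 : ℝ) / 2 = 1 / 2 from rfl] at h
  rw [Real.sqrt_eq_rpow, Real.sqrt_eq_rpow]
  calc |∫ z, F z * G z ∂μ| ≤ ∫ z, |F z * G z| ∂μ := abs_integral_le_integral_abs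
    _ = ∫ z, ‖F z‖ * ‖G z‖ ∂μ := by
        refine integral_congr_ae (Eventually.of_forall fun z => ?_)
        simp only [Real.norm_eq_abs, abs_mul]
    _ ≤ _ := h

/-! ### The tensor square of an `L²` function -/

/-- `Ψ ⊗ Ψ` is a.e.-strongly measurable on the product. [folklore] -/
theorem aestronglyMeasurable_tensor {μ : Measure α} [SFinite μ] {Ψ : α → ℝ} (hΨ : AEStronglyMeasurable Ψ μ) :
    AEStronglyMeasurable (fun z : α × α => Ψ z.1 * Ψ z.2) (μ.prod μ) :=
  hΨ.comp_fst.mul hΨ.comp_snd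

/-- `∫ (Ψ ⊗ Ψ)² d(λ⊗λ) = (∫ Ψ²)²`. [folklore] -/
theorem integral_tensor_sq {μ : Measure α} [SFinite μ] (Ψ : α → ℝ) :
    ∫ z, (Ψ z.1 * Ψ z.2) ^ 2 ∂(μ.prod μ) = (∫ x, Ψ x ^ 2 ∂μ) ^ 2 := by
  have h := integral_prod_mul (μ := μ) (ν := μ) (fun x => Ψ x ^ 2) (fun y => Ψ y ^ 2)
  rw [sq (∫ x, Ψ x ^ 2 ∂μ), ← h]
  refine integral_congr_ae (Eventually.of_forall fun z => ?_)
  ring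

/-- **`Ψ ⊗ Ψ ∈ L²(λ ⊗ λ)`** for `Ψ ∈ L²(λ)`. [folklore] -/
theorem memLp_two_tensor {μ : Measure α} [SFinite μ] {Ψ : α → ℝ} (hΨ : MemLp Ψ 2 μ) :
    MemLp (fun z : α × α => Ψ z.1 * Ψ z.2) 2 (μ.prod μ) := by
  have hmeas := aestronglyMeasurable_tensor hΨ.1
  rw [memLp_two_iff_integrable_sq hmeas]
  have h2 : Integrable (fun x => Ψ x ^ 2) μ := (memLp_two_iff_integrable_sq hΨ.1).1 hΨ
  have h := h2.mul_prod h2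
  refine h.congr (Eventually.of_forall fun z => ?_)
  simp only
  ring

/-! ### The iterated integral as a product integral -/

/-- **Fubini for the quadratic form**: `∫ Ψ(x) (∫ M(x,y) Ψ(y) dλ(y)) dλ(x) = ∫ M · (Ψ ⊗ Ψ) d(λ ⊗ λ)`
for `Ψ ∈ L²(λ)`, `M ∈ L²(λ ⊗ λ)` (the product `M (Ψ⊗Ψ)` of two `L²` functions is integrable).
[folklore] -/
theorem integral_mul_integral_mul_eq_integral_prod {μ : Measure α} [SFinite μ] {Ψ : α → ℝ}
    {M : α × α → ℝ} (hΨ : MemLp Ψ 2 μ) (hM : MemLp M 2 (μ.prod μ)) :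
    ∫ x, Ψ x * ∫ y, M (x, y) * Ψ y ∂μ ∂μ = ∫ z, M z * (Ψ z.1 * Ψ z.2) ∂(μ.prod μ) := by
  have hint : Integrable (fun z : α × α => M z * (Ψ z.1 * Ψ z.2)) (μ.prod μ) :=
    hM.integrable_mul (memLp_two_tensor hΨ)
  rw [integral_prod _ hint]
  refine integral_congr_ae (Eventually.of_forall fun x => ?_)
  simp only
  rw [← integral_const_mul]
  refine integral_congr_ae (Eventually.of_forall fun y => ?_)
  ring

/-- **Hilbert–Schmidt bound for the quadratic form**:
`|∫ Ψ(x) (∫ M(x,y) Ψ(y) dy) dx| ≤ (∫ Ψ²) · √(∫∫ M²)`. [folklore] -/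
theorem abs_integral_mul_integral_mul_le {μ : Measure α} [SFinite μ] {Ψ : α → ℝ} {M : α × α → ℝ}
    (hΨ : MemLp Ψ 2 μ) (hM : MemLp M 2 (μ.prod μ)) :
    |∫ x, Ψ x * ∫ y, M (x, y) * Ψ y ∂μ ∂μ| ≤
      (∫ x, Ψ x ^ 2 ∂μ) * Real.sqrt (∫ z, M z ^ 2 ∂(μ.prod μ)) := by
  rw [integral_mul_integral_mul_eq_integral_prod hΨ hM]
  have h := abs_integral_mul_le_sqrt_mul_sqrt hM (memLp_two_tensor hΨ)
  rw [integral_tensor_sq, Real.sqrt_sq (integral_nonneg fun x => sq_nonneg _)] at h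
  linarith [h]

/-- **Stability of the quadratic form in the kernel**: for `Ψ ∈ L²(λ)` and two kernels
`M₁, M₂ ∈ L²(λ ⊗ λ)`,
`|∫ Ψ (∫ M₁ Ψ) - ∫ Ψ (∫ M₂ Ψ)| ≤ (∫ Ψ²) · ‖M₁ - M₂‖_{L²(λ⊗λ)}`. [folklore] -/
theorem abs_iterated_sub_iterated_le {μ : Measure α} [SFinite μ] {Ψ : α → ℝ} {M₁ M₂ : α × α → ℝ}
    (hΨ : MemLp Ψ 2 μ) (hM₁ : MemLp M₁ 2 (μ.prod μ)) (hM₂ : MemLp M₂ 2 (μ.prod μ)) :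
    |(∫ x, Ψ x * ∫ y, M₁ (x, y) * Ψ y ∂μ ∂μ) - ∫ x, Ψ x * ∫ y, M₂ (x, y) * Ψ y ∂μ ∂μ| ≤
      (∫ x, Ψ x ^ 2 ∂μ) * Real.sqrt (∫ z, (M₁ z - M₂ z) ^ 2 ∂(μ.prod μ)) := by
  have hG := memLp_two_tensor hΨ
  have hint₁ : Integrable (fun z : α × α => M₁ z * (Ψ z.1 * Ψ z.2)) (μ.prod μ) := hM₁.integrable_mul hG
  have hint₂ : Integrable (fun z : α × α => M₂ z * (Ψ z.1 * Ψ z.2)) (μ.prod μ) := hM₂.integrable_mul hG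
  rw [integral_mul_integral_mul_eq_integral_prod hΨ hM₁, integral_mul_integral_mul_eq_integral_prod hΨ hM₂,
    ← integral_sub hint₁ hint₂]
  have hsub : (fun z : α × α => M₁ z * (Ψ z.1 * Ψ z.2) - M₂ z * (Ψ z.1 * Ψ z.2)) =
      fun z => (M₁ z - M₂ z) * (Ψ z.1 * Ψ z.2) := by funext z; ring
  rw [hsub]
  have h := abs_integral_mul_le_sqrt_mul_sqrt (hM₁.sub hM₂) hG
  rw [integral_tensor_sq, Real.sqrt_sq (integral_nonneg fun x => sq_nonneg _)] at h
  have hsub' : (fun z : α × α => (M₁ - M₂) z * (Ψ z.1 * Ψ z.2)) = fun z => (M₁ z - M₂ z) * (Ψ z.1 * Ψ z.2) := by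
    funext z; rfl
  rw [hsub'] at h
  have hsq : (fun z : α × α => (M₁ - M₂) z ^ 2) = fun z => (M₁ z - M₂ z) ^ 2 := by funext z; rfl
  rw [hsq] at h
  linarith [h]

end Summit.HubbardSuperconductivity.HubbardSuperconductivity.Theorems

end
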